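import Literature.Topology.FourManifolds.ThreeTorusHomologyTwo
import Literature.Topology.FourManifolds.HomotopyS4CriterionHurewicz
import Literature.AlgebraicTopology.SingularHomology.HurewiczEilenberg
import Literature.AlgebraicTopology.Homotopy.WhiteheadContractibleLeavesProofs
import HarnessLib

/-!
# Cappell–Shaneson spheres are homotopy 4-spheres: reduction to Poincaré duality alone

Fifth file (after `CappellShanesonHomotopySphere.lean`, `CappellShanesonWang.lean` /
`…WangProofs.lean`, `CappellShanesonHomotopySphereProofs.lean`, `ThreeTorusHomologyTwo.lean`) on
the named fact
`Literature.Topology.FourManifolds.nonempty_homotopyEquiv_sphere_four_of_isCappellShanesonSphere`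
(`CappellShaneson.lean`; S. E. Cappell, J. L. Shaneson, *Some new four-manifolds*, Ann. of Math.
104 (1976), §2; restated in R. E. Gompf, *More Cappell–Shaneson spheres are standard*, Algebr.
Geom. Topol. 10 (2010), §2, first paragraph: "The Cappell-Shaneson examples arise when `M` is the
3-torus, so `φ` is obtained from some `A ∈ SL(3, ℤ)`, and `X^ε_φ` is a homotopy 4-sphere if and
only if `det(A - I) = ±1`").

`ThreeTorusHomologyTwo.lean` proved the fact from (PD₃) Poincaré duality for `T³` in degrees
`(1, 2)` and (W) the recognition of homotopy 4-spheres `nonempty_homotopyEquiv_sphere_four_iff.{0}`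
(`spc4.S10`), and — through `HomotopyS4Criterion.lean` — from the three textbook named facts
Poincaré duality (Hatcher Thm. 3.30), Whitehead's theorem (Cor. 4.33) and the CW homotopy type of
compact manifolds (Cor. A.12) (`…_of_textbookFacts`). Since then the tree has acquired a second
reduction of (W), `nonempty_homotopyEquiv_sphere_four_iff_of_hurewicz`
(`HomotopyS4CriterionHurewicz.lean`: Poincaré duality in bidegree `(1, 3)` + the Hurewicz
isomorphism + Milnor's CW homotopy type of manifolds), **both of whose non-duality inputs are now
theorems of the tree**:

* `Literature.AlgebraicTopology.SingularHomology.hurewicz_iso_of_collapseDevice : hurewicz_iso`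
  (Hatcher Thm. 4.32, isomorphism clause; `HurewiczEilenberg.lean`);
* `Literature.AlgebraicTopology.Homotopy.Manifold.exists_cwComplex_homotopyEquiv_holds`
  (Milnor 1959, Cor. 1; `WhiteheadContractibleLeavesProofs.lean`).

This file records the consequence: **the Cappell–Shaneson homotopy-sphere fact follows from the
single named fact `bijective_poincareDualityMap` (Hatcher Thm. 3.30) with `ℤ` coefficients for
closed manifolds in `Type`**, used in exactly two instances — `T³` in bidegree `(1, 2)` (the
`H₂(T³; ℤ)` computation with its `SL(3, ℤ)`-action, Hatcher §3.C Ex. 11) and closed 4-manifolds in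
bidegree `(1, 3)` (`H¹ ≅ H₃` for the homology-sphere step of `spc4.S10`). Every statement about
`T³`, mapping tori, the circle surgery, the fundamental group, Mayer–Vietoris / Wang sequences,
Hurewicz, Whitehead's criterion and CW homotopy type that the printed argument uses is PROVED in
the tree. The discharge `…_holds` is therefore the one-line specialisation of
`nonempty_homotopyEquiv_sphere_four_of_isCappellShanesonSphere_of_bijective_poincareDualityMap`
to `bijective_poincareDualityMap_holds`, to be appended when Thm. 3.30 is discharged in
`Literature/AlgebraicTopology/SingularHomology/`.

## Main statements (all proved; no definitions, no named facts)

* `Literature.Topology.FourManifolds.nonempty_homotopyEquiv_sphere_four_iff_of_poincareDuality₄`: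
  `spc4.S10` at every universe from Poincaré duality for closed oriented 4-manifolds in `Type`,
  bidegree `(1, 3)`.
* `Literature.Topology.FourManifolds.nonempty_homotopyEquiv_sphere_four_of_isCappellShanesonSphere_of_poincareDuality₃₄`:
  the Cappell–Shaneson fact, every universe, from the two duality instances (PD₃) and (PD₄).
* `Literature.Topology.FourManifolds.nonempty_homotopyEquiv_sphere_four_of_isCappellShanesonSphere_of_bijective_poincareDualityMap`:
  the Cappell–Shaneson fact, every universe, from Hatcher Thm. 3.30 (`ℤ` coefficients, closed
  topological manifolds in `Type`, all bidegrees) alone.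
* `Literature.Topology.FourManifolds.isZero_singularHomologyZ_two_of_isCappellShanesonSphere_of_bijective_poincareDualityMap`:
  the sibling leaf of `CappellShanesonHomotopySphere.lean` from the same single input
  (consistency of the DAG, via `spc4.S10`). The other sibling, simple connectivity
  (`simplyConnectedSpace_of_isCappellShanesonSphere`, `CappellShaneson.lean`), is already
  discharged unconditionally (`simplyConnectedSpace_of_isCappellShanesonSphere_holds`,
  `CappellShanesonProofs.lean`), so no conditional version of it is recorded here.

## References

* S. E. Cappell, J. L. Shaneson, *Some new four-manifolds*, Ann. of Math. 104 (1976) 61–72, §2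
  [CappellShanesonAnnals1976].
* R. E. Gompf, *More Cappell–Shaneson spheres are standard*, Algebr. Geom. Topol. 10 (2010)
  1665–1681, §2 first paragraph, §3 first paragraph [GompfAGT2010].
* A. Hatcher, *Algebraic Topology*, CUP 2002, Thm. 3.30, Thm. 4.32, §3.C Ex. 11 [HatcherAT2002].
* J. Milnor, *On spaces having the homotopy type of a CW-complex*, Trans. AMS 90 (1959), Cor. 1
  [Milnor1959].
* M. H. Freedman, F. Quinn, *Topology of 4-manifolds* (1990), §10.1 [FreedmanQuinnPMS1990].
-/

noncomputable section

open CategoryTheory Limits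
open Literature.AlgebraicTopology.SingularHomology Literature.AlgebraicTopology.Homotopy

namespace Literature.Topology.FourManifolds

universe u

/-! ### `spc4.S10` from Poincaré duality in bidegree `(1, 3)` alone -/

/-- **The recognition of homotopy 4-spheres (`spc4.S10`) from Poincaré duality alone, every
universe.** A closed topological 4-manifold is homotopy equivalent to `S⁴` iff it is simply
connected with `H₂(-; ℤ) = 0` (Freedman–Quinn 1990, §10.1: Hurewicz + Whitehead + Poincaré
duality), GIVEN only Poincaré duality `H¹ ≅ H₃` for closed `ℤ`-oriented topological 4-manifolds in
`Type` (Hatcher Thm. 3.30, hypothesis `hPD₄`): the tree's reduction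
`nonempty_homotopyEquiv_sphere_four_iff_of_hurewicz_univ` fed with the PROVED Hurewicz
isomorphism theorem (`hurewicz_iso_of_collapseDevice`, Hatcher Thm. 4.32) and the PROVED CW
homotopy type of second countable Hausdorff manifolds
(`Manifold.exists_cwComplex_homotopyEquiv_holds`, Milnor 1959, Cor. 1).
[cite: FreedmanQuinnPMS1990, §10.1] [cite: HatcherAT2002, Thm. 3.30 and Thm. 4.32]
[cite: Milnor1959, Cor. 1] -/
theorem nonempty_homotopyEquiv_sphere_four_iff_of_poincareDuality₄
    (hPD₄ : ∀ (M : Type) [TopologicalSpace M] [CompactSpace M] [T2Space M]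
      [ChartedSpace (EuclideanSpace ℝ (Fin 4)) M] (μ : HomologicalOrientation ℤ M 4),
      bijective_poincareDualityMap μ (Nat.add_comm 1 3)) :
    nonempty_homotopyEquiv_sphere_four_iff.{u} :=
  nonempty_homotopyEquiv_sphere_four_iff_of_hurewicz_univ hPD₄ hurewicz_iso_of_collapseDevice
    Manifold.exists_cwComplex_homotopyEquiv_holds

/-! ### The Cappell–Shaneson fact from Poincaré duality alone -/

/-- **Cappell–Shaneson spheres are homotopy 4-spheres, from the two duality instances** (every
universe): the named fact `nonempty_homotopyEquiv_sphere_four_of_isCappellShanesonSphere`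
(Cappell–Shaneson 1976, §2; Gompf 2010, §2 first paragraph) follows from Poincaré duality for
`T³` in bidegree `(1, 2)` (`hPD₃` — the instance `X = T³`, `R = ℤ`, `(p, q) = (1, 2)`,
orientation `ThreeTorus.homologicalOrientation`, written with all implicit arguments as in
`ThreeTorusHomologyTwo.lean` — giving `H₂(T³; ℤ) ≅ ℤ³` with `A` acting by `(A⁻¹)ᵀ`,
`ThreeTorusHomologyTwo.lean`) and for closed `ℤ`-oriented 4-manifolds in `Type` in bidegree
`(1, 3)` (`hPD₄`, giving `spc4.S10`, `nonempty_homotopyEquiv_sphere_four_iff_of_poincareDuality₄`).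
[cite: CappellShanesonAnnals1976, §2] [cite: GompfAGT2010, §2] [cite: HatcherAT2002, Thm. 3.30] -/
theorem nonempty_homotopyEquiv_sphere_four_of_isCappellShanesonSphere_of_poincareDuality₃₄
    (hPD₃ : @bijective_poincareDualityMap ℤ _ ThreeTorus _ 1 2 3 _ _
      threeTorusChartedSpaceFinThree ThreeTorus.homologicalOrientation rfl)
    (hPD₄ : ∀ (M : Type) [TopologicalSpace M] [CompactSpace M] [T2Space M]
      [ChartedSpace (EuclideanSpace ℝ (Fin 4)) M] (μ : HomologicalOrientation ℤ M 4),
      bijective_poincareDualityMap μ (Nat.add_comm 1 3))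
    (X : Type u) [TopologicalSpace X] [ChartedSpace (EuclideanSpace ℝ (Fin 4)) X] :
    nonempty_homotopyEquiv_sphere_four_of_isCappellShanesonSphere X :=
  nonempty_homotopyEquiv_sphere_four_of_isCappellShanesonSphere_of_poincareDuality hPD₃
    (nonempty_homotopyEquiv_sphere_four_iff_of_poincareDuality₄.{0} hPD₄) X

/-- **Cappell–Shaneson spheres are homotopy 4-spheres, from Hatcher's Theorem 3.30 alone**
(every universe): the named fact `nonempty_homotopyEquiv_sphere_four_of_isCappellShanesonSphere`
(Cappell–Shaneson 1976, §2) follows from Poincaré duality `Hᵖ(M; ℤ) ≅ H_q(M; ℤ)`, `p + q = n`,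
for closed `ℤ`-oriented topological `n`-manifolds `M : Type` (the named fact
`bijective_poincareDualityMap`, Hatcher Thm. 3.30, closed over all its arguments at `R = ℤ` and
universe `0`). This is the whole remaining proof obligation of the fact: its discharge is the
specialisation of this theorem to the discharge of Thm. 3.30.
[cite: CappellShanesonAnnals1976, §2] [cite: HatcherAT2002, Thm. 3.30] -/
theorem nonempty_homotopyEquiv_sphere_four_of_isCappellShanesonSphere_of_bijective_poincareDualityMap
    (hPD : ∀ (M : Type) [TopologicalSpace M] [CompactSpace M] [T2Space M] (n : ℕ)
      [ChartedSpace (EuclideanSpace ℝ (Fin n)) M] (μ : HomologicalOrientation ℤ M n) (p q : ℕ)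
      (h : p + q = n), bijective_poincareDualityMap μ h)
    (X : Type u) [TopologicalSpace X] [ChartedSpace (EuclideanSpace ℝ (Fin 4)) X] :
    nonempty_homotopyEquiv_sphere_four_of_isCappellShanesonSphere X :=
  nonempty_homotopyEquiv_sphere_four_of_isCappellShanesonSphere_of_poincareDuality₃₄
    (@hPD ThreeTorus _ _ _ 3 threeTorusChartedSpaceFinThree ThreeTorus.homologicalOrientation 1 2
      rfl)
    (fun M _ _ _ _ μ ↦ hPD M 4 μ 1 3 (Nat.add_comm 1 3)) X

/-! ### The sibling leaf `H₂ = 0` from the same single input -/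

/-- **`H₂ = 0` for Cappell–Shaneson spheres, from Hatcher's Theorem 3.30 alone** (every
universe): the leaf `isZero_singularHomologyZ_two_of_isCappellShanesonSphere` of
`CappellShanesonHomotopySphere.lean` (Cappell–Shaneson 1976, §2), through the homotopy-sphere fact
and `spc4.S10` (`isZero_singularHomologyZ_two_of_isCappellShanesonSphere_of`).
[cite: CappellShanesonAnnals1976, §2] [cite: HatcherAT2002, Thm. 3.30] -/
theorem isZero_singularHomologyZ_two_of_isCappellShanesonSphere_of_bijective_poincareDualityMap
    (hPD : ∀ (M : Type) [TopologicalSpace M] [CompactSpace M] [T2Space M] (n : ℕ)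
      [ChartedSpace (EuclideanSpace ℝ (Fin n)) M] (μ : HomologicalOrientation ℤ M n) (p q : ℕ)
      (h : p + q = n), bijective_poincareDualityMap μ h)
    (X : Type u) [TopologicalSpace X] [ChartedSpace (EuclideanSpace ℝ (Fin 4)) X] :
    isZero_singularHomologyZ_two_of_isCappellShanesonSphere X :=
  isZero_singularHomologyZ_two_of_isCappellShanesonSphere_of
    (nonempty_homotopyEquiv_sphere_four_of_isCappellShanesonSphere_of_bijective_poincareDualityMap
      hPD)
    (nonempty_homotopyEquiv_sphere_four_iff_of_poincareDuality₄
      (fun M _ _ _ _ μ ↦ hPD M 4 μ 1 3 (Nat.add_comm 1 3))) X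

end Literature.Topology.FourManifolds

end
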